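import Mathlib.Algebra.Polynomial.Roots
import Literature.NumberTheory.Automorphic.ZariskiCones
import HarnessLib

/-!
# Weights of a one-parameter diagonal group on `kⁿ`: limits in closed cones and fixed lines
(trunk T-AUTOMORPHIC, G25 AutomorphicL; input of the rank-one analysis `G/B ≅ ℙ¹`, Springer 7.1.5)

Companion to `ZariskiCones.lean` (closed cones in `kⁿ = (ι → k)` as the closed subsets of `ℙ(kⁿ)`,
`IsConeSet`, Zariski topology `zariskiTopologyPi`). For integer weights `m : ι → ℤ` the cocharacter
`c ↦ diag(c^{mᵢ})` of the diagonal torus acts on `kⁿ`; following Springer, *Linear Algebraic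
Groups*, 7.1.5 (proof: "*if the last coordinate of `x ∈ P(V)` is non-zero, then
`x₀* = lim_{a → 0} ρ(a) x*` exists*" and "*the points `x₀*` and `y_∞*` are fixed points for the
action of `φ(T)` on `P(V)`*") we prove, on `k`-points and without limits:

* `weightDiagGL m c` — the element `diag(c^{mᵢ}) ∈ GL ι k`; `weightDiagGL_mulVec`;
* `botPart m w` — the part of `w` of lowest weight among its non-zero coordinates (`minWeight`),
  and the highest-weight part `botPart (-m) w` (`weightDiagGL_neg`);
  **`botPart_mem_of_isClosed`**: a closed cone containing the orbit `{diag(c^{mᵢ}) w}` contains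
  `botPart m w` (the curve `s ↦ s^{-μ} diag(s^{mᵢ}) w` is polynomial in `s` with value `botPart m w`
  at `s = 0`, and a polynomial vanishing on `kˣ` vanishes at `0`); `topPart_mem_of_isClosed`;
* `exists_smul_iff_forall_eq` — a line `k w` is fixed by a diagonal matrix `diag(dᵢ)` iff `dᵢ = dⱼ`
  for all `i, j` in the support of `w`; hence `botPart m w` spans a line fixed by all `diag(c^{mᵢ})`
  (`botPart_fixed`).

## References

* [SpringerLAG1998] T. A. Springer, *Linear Algebraic Groups*, 2nd ed. (1998), 3.2.13, 7.1.5.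
-/

open MvPolynomial Matrix

namespace Literature.NumberTheory.Automorphic

variable {k : Type*} [Field k] {ι : Type*} [Fintype ι]

attribute [local instance] zariskiTopologyPi

/-! ### The one-parameter diagonal group `c ↦ diag(c^{mᵢ})` -/

section ZPowDiag

variable [DecidableEq ι]

/-- `diag(c^{m i}) ∈ GL ι k`: the cocharacter of the diagonal torus with weights `m`
(Springer 3.2.2: the cocharacters of `𝔻ₙ` are `x ↦ diag(x^{a₁}, …, x^{aₙ})`). [cite: SpringerLAG1998, 3.2.2] -/
noncomputable def weightDiagGL (m : ι → ℤ) (c : kˣ) : GL ι k :=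
  diagonalGL ι k fun i => c ^ m i

/-- `diag(c^{mᵢ}) w = (c^{mᵢ} wᵢ)ᵢ`. [folklore] -/
theorem weightDiagGL_mulVec (m : ι → ℤ) (c : kˣ) (w : ι → k) :
    ((weightDiagGL m c : GL ι k) : Matrix ι ι k) *ᵥ w = fun i => ((c ^ m i : kˣ) : k) * w i := by
  ext i
  simp [weightDiagGL, mulVec_diagonal]

/-- Negating the weights inverts the parameter: `diag(c^{-mᵢ}) = diag((c⁻¹)^{mᵢ})`. [folklore] -/
theorem weightDiagGL_neg (m : ι → ℤ) (c : kˣ) :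
    weightDiagGL (k := k) (fun i => -m i) c = weightDiagGL m c⁻¹ := by
  unfold weightDiagGL
  congr 1
  funext i
  rw [zpow_neg, inv_zpow]

end ZPowDiag

/-! ### The lowest-weight part of a vector and limits in closed cones -/

section BotPart

variable (m : ι → ℤ) (w : ι → k)

open Classical in
/-- The lowest weight among the non-zero coordinates of `w` (and `0` if `w = 0`). [folklore] -/
noncomputable def minWeight : ℤ :=
  if h : (Finset.univ.filter fun i => w i ≠ 0).Nonempty then
    (Finset.univ.filter fun i => w i ≠ 0).inf' h m else 0

/-- The lowest weight is attained at a non-zero coordinate's weight and is `≤` all of them. [folklore] -/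
theorem minWeight_le {i : ι} (hi : w i ≠ 0) : minWeight m w ≤ m i := by
  classical
  have hne : (Finset.univ.filter fun i => w i ≠ 0).Nonempty := ⟨i, by simp [hi]⟩
  rw [minWeight, dif_pos hne]
  exact Finset.inf'_le _ (by simp [hi])

/-- **The lowest-weight part** of `w`: keep the coordinates of weight `minWeight m w`, kill the
others (`lim_{c → 0} c^{-μ} diag(c^{mᵢ}) w`). [folklore] -/
noncomputable def botPart : ι → k := fun i => if m i = minWeight m w then w i else 0

/-- `botPart m w ≠ 0` if `w ≠ 0`. [folklore] -/
theorem botPart_ne_zero (hw : w ≠ 0) : botPart m w ≠ 0 := by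
  classical
  have hne : (Finset.univ.filter fun i => w i ≠ 0).Nonempty := by
    by_contra h
    rw [Finset.not_nonempty_iff_eq_empty, Finset.filter_eq_empty_iff] at h
    exact hw (funext fun i => by simpa using h (Finset.mem_univ i))
  obtain ⟨i, hi, hieq⟩ := Finset.exists_mem_eq_inf' hne m
  have hwi : w i ≠ 0 := by simpa using hi
  intro h0
  have := congrFun h0 i
  rw [botPart, minWeight, dif_pos hne, ← hieq, if_pos rfl] at this
  exact hwi this

/-- The coordinates of `botPart m w` all have weight `minWeight m w`. [folklore] -/
theorem botPart_apply_eq_zero {i : ι} (hi : m i ≠ minWeight m w) : botPart m w i = 0 := by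
  simp [botPart, hi]

/-- The support of `botPart m w` lies in that of `w`. [folklore] -/
theorem botPart_apply_ne_zero {i : ι} (hi : botPart m w i ≠ 0) : w i ≠ 0 ∧ m i = minWeight m w := by
  unfold botPart at hi
  split_ifs at hi with h
  · exact ⟨hi, h⟩
  · exact absurd rfl hi

open Classical in
/-- The polynomial curve `s ↦ (s^{mᵢ - μ} wᵢ)ᵢ` (`μ` the lowest weight; coordinates off the support
of `w` are `0`): for `s ≠ 0` it is `s^{-μ} diag(s^{mᵢ}) w`, and at `s = 0` it is `botPart m w`. [folklore] -/
noncomputable def botCurvePoly (i : ι) : Polynomial k :=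
  if w i = 0 then 0 else Polynomial.C (w i) * Polynomial.X ^ (m i - minWeight m w).toNat

/-- Value of the curve at `s ≠ 0`. [folklore] -/
theorem eval_botCurvePoly_units (c : kˣ) (i : ι) :
    (botCurvePoly m w i).eval (c : k) =
      ((c ^ (-minWeight m w) : kˣ) : k) * (((c ^ m i : kˣ) : k) * w i) := by
  classical
  unfold botCurvePoly
  split_ifs with h
  · simp [h]
  · rw [Polynomial.eval_mul, Polynomial.eval_C, Polynomial.eval_pow, Polynomial.eval_X, ← mul_assoc,
      mul_comm (w i), ← Units.val_pow_eq_pow_val, ← zpow_natCast,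
      Int.toNat_of_nonneg (sub_nonneg.2 (minWeight_le m w h)), ← Units.val_mul, ← zpow_add,
      neg_add_eq_sub]

/-- Value of the curve at `s = 0`. [folklore] -/
theorem eval_botCurvePoly_zero (i : ι) : (botCurvePoly m w i).eval 0 = botPart m w i := by
  classical
  unfold botCurvePoly botPart
  by_cases h1 : w i = 0
  · simp [h1]
  · rw [if_neg h1]
    by_cases h2 : m i = minWeight m w
    · rw [if_pos h2, h2, sub_self, Int.toNat_zero, pow_zero, mul_one, Polynomial.eval_C]
    · have hpos : 0 < (m i - minWeight m w).toNat := by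
        have := minWeight_le m w h1
        omega
      rw [if_neg h2]
      simp [zero_pow hpos.ne']

/-- **A closed cone containing the orbit `{diag(c^{mᵢ}) w | c ≠ 0}` contains the lowest-weight part
of `w`** (Springer 7.1.5, proof: the limit point `lim_{a → 0} ρ(a) x*` exists in the closed set;
here: every polynomial vanishing on the cone vanishes along the polynomial curve
`s ↦ s^{-μ} diag(s^{mᵢ}) w` for `s ≠ 0`, hence at `s = 0`). [cite: SpringerLAG1998, 7.1.5 (proof)] -/
theorem botPart_mem_of_isClosed [DecidableEq ι] [Infinite k] {C : Set (ι → k)} (hC : IsConeSet C) (hcl : IsClosed C)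
    (horb : ∀ c : kˣ, ((weightDiagGL m c : GL ι k) : Matrix ι ι k) *ᵥ w ∈ C) : botPart m w ∈ C := by
  classical
  obtain ⟨S, hS⟩ := isClosed_iff_exists_setOf_eval.1 hcl
  rw [hS]
  intro p hpS
  -- `q(s) = p(curve(s))` vanishes on `kˣ`, hence is zero
  set q : Polynomial k := MvPolynomial.aeval (botCurvePoly m w) p with hq
  have hqeval : ∀ s : k, q.eval s = MvPolynomial.eval (fun i => (botCurvePoly m w i).eval s) p := by
    intro s
    rw [hq, ← Polynomial.coe_aeval_eq_eval, ← AlgHom.comp_apply, MvPolynomial.comp_aeval,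
      MvPolynomial.aeval_eq_eval]
  have hq0 : q = 0 := by
    apply Polynomial.eq_zero_of_infinite_isRoot
    refine Set.Infinite.mono (s := {s : k | s ≠ 0}) (fun s (hs : s ≠ 0) => ?_) ?_
    · have hmem : (fun i => (botCurvePoly m w i).eval s) ∈ C := by
        have h1 := hC _ (Units.ne_zero ((Units.mk0 s hs) ^ (-minWeight m w))) _ (horb (Units.mk0 s hs))
        rw [weightDiagGL_mulVec] at h1
        convert h1 using 1
        funext i
        have := eval_botCurvePoly_units m w (Units.mk0 s hs) i
        rw [Units.val_mk0] at this
        rw [this]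
        rfl
      rw [hS] at hmem
      show Polynomial.IsRoot q s
      rw [Polynomial.IsRoot.def, hqeval]
      exact hmem p hpS
    · have : ({s : k | s ≠ 0}) = (Set.univ \ {0}) := by ext; simp
      rw [this]
      exact Set.infinite_univ.sdiff (Set.finite_singleton 0)
  have h0 := hqeval 0
  rw [hq0, Polynomial.eval_zero] at h0
  rw [show botPart m w = fun i => (botCurvePoly m w i).eval 0 from
    funext fun i => (eval_botCurvePoly_zero m w i).symm]
  exact h0.symm

/-- **The highest-weight part** `botPart (-m) w` of `w` lies in every closed cone containing the
orbit `{diag(c^{mᵢ}) w}` (`lim_{a → ∞}`, Springer 7.1.5, proof). [cite: SpringerLAG1998, 7.1.5 (proof)] -/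
theorem topPart_mem_of_isClosed [DecidableEq ι] [Infinite k] {C : Set (ι → k)} (hC : IsConeSet C)
    (hcl : IsClosed C) (horb : ∀ c : kˣ, ((weightDiagGL m c : GL ι k) : Matrix ι ι k) *ᵥ w ∈ C) :
    botPart (fun i => -m i) w ∈ C :=
  botPart_mem_of_isClosed (fun i => -m i) w hC hcl fun c => by rw [weightDiagGL_neg]; exact horb c⁻¹

end BotPart

/-! ### Lines fixed by diagonal matrices -/

section Fixed

/-- **A line `k w` is fixed by `diag(d)` iff the entries `dᵢ` agree on the support of `w`.** [folklore] -/
theorem exists_smul_iff_forall_eq (d w : ι → k) :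
    (∃ c : k, (fun i => d i * w i) = c • w) ↔ ∀ i j, w i ≠ 0 → w j ≠ 0 → d i = d j := by
  constructor
  · rintro ⟨c, hc⟩ i j hi hj
    have h1 := congrFun hc i
    have h2 := congrFun hc j
    simp only [Pi.smul_apply, smul_eq_mul] at h1 h2
    rw [mul_right_cancel₀ hi h1, mul_right_cancel₀ hj h2]
  · intro h
    by_cases hw : ∃ i, w i ≠ 0
    · obtain ⟨i₀, hi₀⟩ := hw
      refine ⟨d i₀, funext fun i => ?_⟩
      by_cases hi : w i = 0
      · simp [hi]
      · simp only [Pi.smul_apply, smul_eq_mul]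
        rw [h i i₀ hi hi₀]
    · push Not at hw
      refine ⟨0, funext fun i => ?_⟩
      simp [hw i]

/-- The lowest-weight part of `w` spans a line fixed by every `diag(c^{mᵢ})`. [folklore] -/
theorem botPart_fixed [DecidableEq ι] (m : ι → ℤ) (w : ι → k) (c : kˣ) :
    ∃ a : k, ((weightDiagGL m c : GL ι k) : Matrix ι ι k) *ᵥ botPart m w = a • botPart m w := by
  rw [weightDiagGL_mulVec, exists_smul_iff_forall_eq]
  intro i j hi hj
  rw [(botPart_apply_ne_zero m w hi).2, (botPart_apply_ne_zero m w hj).2]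

end Fixed

end Literature.NumberTheory.Automorphic
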